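import Summits.QuantumFields.YangMills.Theorems.ColdStartUniversalityLatticeLangevinNoiseFrame
import Summits.QuantumFields.YangMills.Theorems.ColdStartUniversalityLatticeLangevinFrameCalculus
import Summits.QuantumFields.YangMills.Theorems.ColdStartUniversalityLatticeLangevinGradientDriftFlatDrift
import Summits.QuantumFields.YangMills.Theorems.ColdStartUniversalityLatticeLangevinCarreDuChampDictionary
import Summits.QuantumFields.YangMills.Theorems.ColdStartUniversalityLatticeLangevinWilsonFrameIBP
import HarnessLib

/-!
# Route `ColdStartUniversality` (fixed-cut-off package, Bakry–Émery side): the SZZ coordinate generator in FRAME FORM,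
# `𝓛 f = ½ Σ_n (W_n W_n f + W_n ψ̂ · W_n f)`

Helper file (seat `ym-line-csu-p1`, g25; `--supports stmt-QuantumFields-24809`).  The coordinate generator of the SU(2) lattice Langevin
dynamics of Shen–Zhu–Zhu at coupling `β'` (the integrand of `dynkin_expectation_szz`: `𝓛f(y) = Σ_i ∂_i f · b_i + ½ Σ_(ij) ∂_j∂_i f (σσᵀ)_(ij)`,
drift `b = (driftLie + C_𝔤)·Q`, noise `σ_n = √2·𝐩(E_ν)Q_e`) equals, at every configuration,
  `½ Σ_n ( W_n(W_n f) + W_n ψ̂ · W_n f )`,  `W_n f(y) = Df(y)[s_n y]`,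
for the noise frame `s_n` of `…NoiseFrame` and the plaquette function `ψ̂ = β'Σ_p Re tr U_p` (★★ `generator_eq_half_frameGen`).
Ingredients: the second-order part is `½ Σ_n D²f[s_n, s_n]` (bilinearity), the Casimir drift `C_𝔤 Q` is `½ Df[Σ_n s_n(s_n y)]`
(`exists_noiseFrame` (5)), and the `β'`-drift is `½ Σ_n W_nψ̂ · W_n f` by SZZ Lemma 3.1 in coordinates (`driftLie_mul_entry_eq_half_sum`, g7).
This identifies the SZZ generator with `½𝓛'` for the frame generator `𝓛' = Σ_n W_n² + (W_nψ̂)W_n` of `…FrameBochner`.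
THEOREMS ONLY, no definition, no sorry.  HONEST FRAMING: fixed cut-off bookkeeping; nothing K-uniform; no statement about the YM mass gap.
-/

set_option autoImplicit false

noncomputable section

namespace Summit.QuantumFields.YangMills.Theorems.ColdStartUniversality

open Matrix Complex Finset
open scoped ComplexConjugate BigOperators Matrix
open Literature.MathematicalPhysics.QuantumFieldTheory
open Literature.MathematicalPhysics.QuantumLattice (fundamentalRep fundamentalLatticeRep fundamentalRep_apply)

variable {L : ℕ} [NeZero L]

/-! ## §1. Second derivatives along constant directions; bilinear sums -/

omit [NeZero L] in
/-- `∂_w (z ↦ Df(z)[c]) = D²f(y)[w][c]` for a constant direction `c`. [folklore] -/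
theorem fderiv_fderiv_const_apply {E : Type*} [NormedAddCommGroup E] [NormedSpace ℝ E] {f : E → ℝ} (hf : ContDiff ℝ 2 f)
    (y c w : E) : fderiv ℝ (fun z => fderiv ℝ f z c) y w = fderiv ℝ (fderiv ℝ f) y w c := by
  have hd : DifferentiableAt ℝ (fderiv ℝ f) y :=
    ((hf.fderiv_right (m := 1) (by norm_num)).differentiable (by norm_num)).differentiableAt
  rw [fderiv_clm_apply hd (differentiableAt_const c)]
  simp only [fderiv_fun_const, Pi.zero_apply, ContinuousLinearMap.comp_zero, zero_add, ContinuousLinearMap.flip_apply]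

/-- `Σ_i Σ_j B[e_j][e_i] c_i d_j = B[d][c]` for a continuous bilinear `B` on coordinate space. [folklore] -/
theorem sum_sum_apply_single_single_mul_mul {ι : Type*} [Fintype ι] [DecidableEq ι] (B : (ι → ℝ) →L[ℝ] (ι → ℝ) →L[ℝ] ℝ)
    (c d : ι → ℝ) : ∑ i, ∑ j, B (Pi.single j 1) (Pi.single i 1) * (c i * d j) = B d c := by
  have h1 : ∀ j, ∑ i, B (Pi.single j 1) (Pi.single i 1) * c i = B (Pi.single j 1) c :=
    fun j => sum_apply_single_mul_eq_apply (B (Pi.single j 1)) c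
  calc ∑ i, ∑ j, B (Pi.single j 1) (Pi.single i 1) * (c i * d j)
      = ∑ j, (∑ i, B (Pi.single j 1) (Pi.single i 1) * c i) * d j := by
        rw [Finset.sum_comm]
        refine Finset.sum_congr rfl fun j _ => ?_
        rw [Finset.sum_mul]
        refine Finset.sum_congr rfl fun i _ => ?_
        ring
    _ = ∑ j, ((ContinuousLinearMap.apply ℝ ℝ c).comp B) (Pi.single j 1) * d j := by
        refine Finset.sum_congr rfl fun j _ => ?_
        rw [h1 j]; rfl
    _ = B d c := by rw [sum_apply_single_mul_eq_apply]; rfl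

omit [NeZero L] in
/-- `Σ_i Σ_j B_{ji} (Σ_n σ_{in} σ_{jn}) = Σ_n Σ_i Σ_j B_{ji} σ_{in} σ_{jn}`. [folklore] -/
theorem sum_sum_mul_sum_cov {ι κ : Type*} [Fintype ι] [Fintype κ] (B : ι → ι → ℝ) (σ : ι → κ → ℝ) :
    ∑ i, ∑ j, B j i * ∑ n, σ i n * σ j n = ∑ n, ∑ i, ∑ j, B j i * (σ i n * σ j n) := by
  calc ∑ i, ∑ j, B j i * ∑ n, σ i n * σ j n = ∑ i, ∑ j, ∑ n, B j i * (σ i n * σ j n) := by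
        simp_rw [Finset.mul_sum]
    _ = ∑ i, ∑ n, ∑ j, B j i * (σ i n * σ j n) := Finset.sum_congr rfl fun i _ => Finset.sum_comm
    _ = ∑ n, ∑ i, ∑ j, B j i * (σ i n * σ j n) := Finset.sum_comm

omit [NeZero L] in
/-- `Σ_i a_i · (½ Σ_q (Σ_n σ_{in}σ_{qn}) b_q) = ½ Σ_n (Σ_q b_q σ_{qn}) (Σ_i a_i σ_{in})`. [folklore] -/
theorem sum_mul_half_sum_cov {ι κ : Type*} [Fintype ι] [Fintype κ] (a b : ι → ℝ) (σ : ι → κ → ℝ) :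
    ∑ i, a i * (1 / 2 * ∑ q, (∑ n, σ i n * σ q n) * b q) = 1 / 2 * ∑ n, (∑ q, b q * σ q n) * (∑ i, a i * σ i n) := by
  calc ∑ i, a i * (1 / 2 * ∑ q, (∑ n, σ i n * σ q n) * b q)
      = ∑ i, ∑ q, ∑ n, 1 / 2 * (a i * σ i n) * (b q * σ q n) := by
        refine Finset.sum_congr rfl fun i _ => ?_
        rw [Finset.mul_sum, Finset.mul_sum]
        refine Finset.sum_congr rfl fun q _ => ?_
        rw [Finset.sum_mul, Finset.mul_sum, Finset.mul_sum]
        refine Finset.sum_congr rfl fun n _ => ?_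
        ring
    _ = ∑ q, ∑ i, ∑ n, 1 / 2 * (a i * σ i n) * (b q * σ q n) := Finset.sum_comm
    _ = ∑ q, ∑ n, ∑ i, 1 / 2 * (a i * σ i n) * (b q * σ q n) := Finset.sum_congr rfl fun q _ => Finset.sum_comm
    _ = ∑ n, ∑ q, ∑ i, 1 / 2 * (a i * σ i n) * (b q * σ q n) := Finset.sum_comm
    _ = 1 / 2 * ∑ n, (∑ q, b q * σ q n) * (∑ i, a i * σ i n) := by
        rw [Finset.mul_sum]
        refine Finset.sum_congr rfl fun n _ => ?_
        rw [Finset.sum_mul_sum, Finset.mul_sum]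
        refine Finset.sum_congr rfl fun q _ => ?_
        rw [Finset.mul_sum]
        refine Finset.sum_congr rfl fun i _ => ?_
        ring

omit [NeZero L] in
/-- The drift splits coordinatewise: `Re/Im((driftLie·Q + C_𝔤·Q)_ab) = Re/Im((driftLie·Q)_ab) + Re/Im((C_𝔤 Q)_ab)`. [folklore] -/
theorem drift_reIm_split' (β' : ℝ) (Q : MatrixConfig 3 L (fundamentalLatticeRep 2).N) (q : Edge 3 L × Fin (fundamentalLatticeRep 2).N × Fin (fundamentalLatticeRep 2).N × Bool) :
    (fun z : ℂ => if q.2.2.2 then z.im else z.re) ((latticeLangevinDynamics (fundamentalLatticeRep 2) β').drift Q q.1 q.2.1 q.2.2.1) =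
      (fun z : ℂ => if q.2.2.2 then z.im else z.re) (((fundamentalLatticeRep 2).driftLie β' Q q.1 * Q q.1) q.2.1 q.2.2.1) +
        (fun z : ℂ => if q.2.2.2 then z.im else z.re) (((fundamentalLatticeRep 2).casimir * Q q.1) q.2.1 q.2.2.1) := by
  have hmat : (latticeLangevinDynamics (fundamentalLatticeRep 2) β').drift Q q.1 = (fundamentalLatticeRep 2).driftLie β' Q q.1 * Q q.1 + (fundamentalLatticeRep 2).casimir * Q q.1 := by
    rw [latticeLangevinDynamics_drift, Matrix.add_mul]
  have hentry := congrFun (congrFun hmat q.2.1) q.2.2.1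
  rw [Matrix.add_apply] at hentry
  rw [hentry]
  cases q.2.2.2
  · simp [Complex.add_re]
  · simp [Complex.add_im]

omit [NeZero L] in
/-- `Re/Im((2·M)_ab) = 2·Re/Im(M_ab)` for the Casimir term. [folklore] -/
theorem reIm_two_smul_casimir_mul (Q : MatrixConfig 3 L (fundamentalLatticeRep 2).N) (q : Edge 3 L × Fin (fundamentalLatticeRep 2).N × Fin (fundamentalLatticeRep 2).N × Bool) :
    (fun z : ℂ => if q.2.2.2 then z.im else z.re) ((((2 : ℝ) : ℂ) • ((fundamentalLatticeRep 2).casimir * Q q.1)) q.2.1 q.2.2.1) =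
      2 * (fun z : ℂ => if q.2.2.2 then z.im else z.re) (((fundamentalLatticeRep 2).casimir * Q q.1) q.2.1 q.2.2.1) := by
  have hentry : (((2 : ℝ) : ℂ) • ((fundamentalLatticeRep 2).casimir * Q q.1)) q.2.1 q.2.2.1 = ((2 : ℝ) : ℂ) * ((fundamentalLatticeRep 2).casimir * Q q.1) q.2.1 q.2.2.1 :=
    rfl
  rw [hentry]
  cases q.2.2.2
  · simp [Complex.mul_re]
  · simp [Complex.mul_im]

/-! ## §2. The generator in frame form -/

/-- ★★ **The SZZ coordinate generator is `½ Σ_n (W_n W_n + W_nψ̂ · W_n)`.**  For every noise frame `s` as in `exists_noiseFrame`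
(fields `s_n y = coords δ_e(√2 𝐩(E_ν) rebuild(y)_e)` with Casimir sum `Σ_n s_n(s_n y) = coords(2·C_𝔤·rebuild y)`), every `C²` function
`f` of the real link coordinates, every coupling `β'` and configuration `V`:
`𝓛_(β') f (V) = ½ Σ_n ( D(Df[s_n])(coords V)[s_n(coords V)] + Dψ̂(coords V)[s_n] · Df(coords V)[s_n] )`, `ψ̂ = β' Σ_p Re tr U_p`.
[cite: ShenZhuZhu2022, §3 Lemma 3.1 and the SDE system following it] -/
theorem generator_eq_half_frameGen (L : ℕ) [NeZero L] (β' : ℝ)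
    (s : (Edge 3 L × NoiseIdx (fundamentalLatticeRep 2).N) → ((Edge 3 L × Fin (fundamentalLatticeRep 2).N × Fin (fundamentalLatticeRep 2).N × Bool → ℝ) →L[ℝ] (Edge 3 L × Fin (fundamentalLatticeRep 2).N × Fin (fundamentalLatticeRep 2).N × Bool → ℝ)))
    (hs : ∀ (n : Edge 3 L × NoiseIdx (fundamentalLatticeRep 2).N) (y : (Edge 3 L × Fin (fundamentalLatticeRep 2).N × Fin (fundamentalLatticeRep 2).N × Bool → ℝ)), s n y = (fun q : Edge 3 L × Fin (fundamentalLatticeRep 2).N × Fin (fundamentalLatticeRep 2).N × Bool => if n.1 = q.1 then (fun z : ℂ => if q.2.2.2 then z.im else z.re) (((Real.sqrt 2 : ℂ) • ((fundamentalLatticeRep 2).lieProj (noiseDir n.2) * (fun (ee : Edge 3 L) => Matrix.of fun (i j : Fin (fundamentalLatticeRep 2).N) => ((y (ee, i, j, false) : ℝ) : ℂ) + ((y (ee, i, j, true) : ℝ) : ℂ) * Complex.I) q.1)) q.2.1 q.2.2.1) else 0))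
    (hCas : ∀ (y : (Edge 3 L × Fin (fundamentalLatticeRep 2).N × Fin (fundamentalLatticeRep 2).N × Bool → ℝ)), ∑ n, s n (s n y) = (fun q : Edge 3 L × Fin (fundamentalLatticeRep 2).N × Fin (fundamentalLatticeRep 2).N × Bool => (fun z : ℂ => if q.2.2.2 then z.im else z.re) ((fun ee => ((2 : ℝ) : ℂ) • ((fundamentalLatticeRep 2).casimir * (fun (ee : Edge 3 L) => Matrix.of fun (i j : Fin (fundamentalLatticeRep 2).N) => ((y (ee, i, j, false) : ℝ) : ℂ) + ((y (ee, i, j, true) : ℝ) : ℂ) * Complex.I) ee)) q.1 q.2.1 q.2.2.1)))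
    (f : (Edge 3 L × Fin 2 × Fin 2 × Bool → ℝ) → ℝ) (hf : ContDiff ℝ 2 f) (V : (GaugeConfig 3 L (Matrix.specialUnitaryGroup (Fin 2) ℂ))) :
    let coords : GaugeConfig 3 L (Matrix.specialUnitaryGroup (Fin 2) ℂ) → (Edge 3 L × Fin 2 × Fin 2 × Bool → ℝ) :=
      fun V q => (fun z : ℂ => if q.2.2.2 then z.im else z.re)
        ((fundamentalRep (Fin 2) (V q.1) : Matrix (Fin 2) (Fin 2) ℂ) q.2.1 q.2.2.1)
    let gen : ((Edge 3 L × Fin 2 × Fin 2 × Bool → ℝ) → ℝ) → GaugeConfig 3 L (Matrix.specialUnitaryGroup (Fin 2) ℂ) → ℝ :=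
      fun h V =>
      (∑ i : Edge 3 L × Fin 2 × Fin 2 × Bool, fderiv ℝ h (coords V) (Pi.single i 1) *
          (fun z : ℂ => if i.2.2.2 then z.im else z.re)
            ((latticeLangevinDynamics (fundamentalLatticeRep 2) β').drift
              (matrixConfig (fundamentalRep (Fin 2)) V) i.1 i.2.1 i.2.2.1) +
      1 / 2 * ∑ i : Edge 3 L × Fin 2 × Fin 2 × Bool, ∑ j : Edge 3 L × Fin 2 × Fin 2 × Bool,
        fderiv ℝ (fun z => fderiv ℝ h z (Pi.single i 1)) (coords V) (Pi.single j 1) *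
          ∑ n : Edge 3 L × NoiseIdx 2,
            (if n.1 = i.1 then (fun z : ℂ => if i.2.2.2 then z.im else z.re)
              ((latticeLangevinDynamics (fundamentalLatticeRep 2) β').noise
                (matrixConfig (fundamentalRep (Fin 2)) V) i.1 n.2 i.2.1 i.2.2.1) else 0) *
            (if n.1 = j.1 then (fun z : ℂ => if j.2.2.2 then z.im else z.re)
              ((latticeLangevinDynamics (fundamentalLatticeRep 2) β').noise
                (matrixConfig (fundamentalRep (Fin 2)) V) j.1 n.2 j.2.1 j.2.2.1) else 0))
    gen f V = 1 / 2 * ∑ n : Edge 3 L × NoiseIdx (fundamentalLatticeRep 2).N,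
      (fderiv ℝ (fun w => fderiv ℝ f w (s n w)) (coords V) (s n (coords V)) +
        fderiv ℝ (fun y : (Edge 3 L × Fin (fundamentalLatticeRep 2).N × Fin (fundamentalLatticeRep 2).N × Bool → ℝ) => β' * ∑ p : Plaquette 3 L, (rootedLoop (fun (ee : Edge 3 L) (i j : Fin (fundamentalLatticeRep 2).N) => ((y (ee, i, j, false) : ℝ) : ℂ) + ((y (ee, i, j, true) : ℝ) : ℂ) * Complex.I) (p.1, p.2.1.1) p.2.1.2 false).trace.re) (coords V) (s n (coords V)) * fderiv ℝ f (coords V) (s n (coords V))) := by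
  intro coords gen
  classical
  -- notation: the Fin-2 world of the tree
  set x : (Edge 3 L × Fin 2 × Fin 2 × Bool → ℝ) := coords V with hx
  set Q : MatrixConfig 3 L (fundamentalLatticeRep 2).N := matrixConfig (fundamentalRep (Fin 2)) V with hQ
  set s2 : (Edge 3 L × NoiseIdx (fundamentalLatticeRep 2).N) → ((Edge 3 L × Fin 2 × Fin 2 × Bool → ℝ) →L[ℝ] (Edge 3 L × Fin 2 × Fin 2 × Bool → ℝ)) := s with hs2def
  set ψ : (Edge 3 L × Fin 2 × Fin 2 × Bool → ℝ) → ℝ := fun y : (Edge 3 L × Fin 2 × Fin 2 × Bool → ℝ) => β' * ∑ p : Plaquette 3 L, (rootedLoop (fun (ee : Edge 3 L) (i j : Fin 2) =>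
      ((y (ee, i, j, false) : ℝ) : ℂ) + ((y (ee, i, j, true) : ℝ) : ℂ) * Complex.I) (p.1, p.2.1.1) p.2.1.2 false).trace.re
    with hψ
  -- rebuild x = Q
  have hreb : (fun (ee : Edge 3 L) => Matrix.of fun (i j : Fin (fundamentalLatticeRep 2).N) => ((x (ee, i, j, false) : ℝ) : ℂ) + ((x (ee, i, j, true) : ℝ) : ℂ) * Complex.I) = fun ee => Q ee :=
    (rebuild_coords_of V).trans (by funext ee; ext a b; rfl)
  have hs2 : ∀ (n : Edge 3 L × NoiseIdx (fundamentalLatticeRep 2).N) (y : (Edge 3 L × Fin 2 × Fin 2 × Bool → ℝ)), s2 n y = (fun q : Edge 3 L × Fin (fundamentalLatticeRep 2).N × Fin (fundamentalLatticeRep 2).N × Bool => if n.1 = q.1 then (fun z : ℂ => if q.2.2.2 then z.im else z.re) (((Real.sqrt 2 : ℂ) • ((fundamentalLatticeRep 2).lieProj (noiseDir n.2) * (fun (ee : Edge 3 L) => Matrix.of fun (i j : Fin (fundamentalLatticeRep 2).N) => ((y (ee, i, j, false) : ℝ) : ℂ) + ((y (ee, i, j, true) : ℝ) : ℂ) * Complex.I)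 q.1)) q.2.1 q.2.2.1) else 0) := fun n y => hs n y
  have hCas2 : ∀ y : (Edge 3 L × Fin 2 × Fin 2 × Bool → ℝ), ∑ n, s2 n (s2 n y) = (fun q : Edge 3 L × Fin (fundamentalLatticeRep 2).N × Fin (fundamentalLatticeRep 2).N × Bool => (fun z : ℂ => if q.2.2.2 then z.im else z.re) ((fun ee => ((2 : ℝ) : ℂ) • ((fundamentalLatticeRep 2).casimir * (fun (ee : Edge 3 L) => Matrix.of fun (i j : Fin (fundamentalLatticeRep 2).N) => ((y (ee, i, j, false) : ℝ) : ℂ) + ((y (ee, i, j, true) : ℝ) : ℂ) * Complex.I) ee)) q.1 q.2.1 q.2.2.1)) :=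
    fun y => hCas y
  -- the frame vectors at `x` are the tree's noise coefficients
  have hsn : ∀ (n : Edge 3 L × NoiseIdx (fundamentalLatticeRep 2).N) (i : (Edge 3 L × Fin 2 × Fin 2 × Bool)), s2 n x i = (if n.1 = i.1 then (fun z : ℂ => if i.2.2.2 then z.im else z.re) ((latticeLangevinDynamics (fundamentalLatticeRep 2) β').noise Q i.1 n.2 i.2.1 i.2.2.1) else 0) := by
    intro n i
    rw [hs2 n x, hreb]
    simp only [latticeLangevinDynamics_noise]
  have hsum1 : ∀ (D : (Edge 3 L × Fin 2 × Fin 2 × Bool → ℝ) →L[ℝ] ℝ) (n : Edge 3 L × NoiseIdx (fundamentalLatticeRep 2).N),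
      ∑ i : (Edge 3 L × Fin 2 × Fin 2 × Bool), D (Pi.single i 1) * (if n.1 = i.1 then (fun z : ℂ => if i.2.2.2 then z.im else z.re) ((latticeLangevinDynamics (fundamentalLatticeRep 2) β').noise Q i.1 n.2 i.2.1 i.2.2.1) else 0) = D (s2 n x) := by
    intro D n
    rw [sum_apply_single_mul_eq_apply]
    congr 1
    funext i
    exact (hsn n i).symm
  -- second-order term
  have hterm2 : ∑ i : (Edge 3 L × Fin 2 × Fin 2 × Bool), ∑ j : (Edge 3 L × Fin 2 × Fin 2 × Bool), fderiv ℝ (fun z => fderiv ℝ f z (Pi.single i 1)) x (Pi.single j 1) *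
      ∑ n : Edge 3 L × NoiseIdx 2, (if n.1 = i.1 then (fun z : ℂ => if i.2.2.2 then z.im else z.re) ((latticeLangevinDynamics (fundamentalLatticeRep 2) β').noise Q i.1 n.2 i.2.1 i.2.2.1) else 0) * (if n.1 = j.1 then (fun z : ℂ => if j.2.2.2 then z.im else z.re) ((latticeLangevinDynamics (fundamentalLatticeRep 2) β').noise Q j.1 n.2 j.2.1 j.2.2.1) else 0) =
      ∑ n : Edge 3 L × NoiseIdx (fundamentalLatticeRep 2).N, fderiv ℝ (fderiv ℝ f) x (s2 n x) (s2 n x) := by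
    have h1 : ∀ i j : (Edge 3 L × Fin 2 × Fin 2 × Bool), fderiv ℝ (fun z => fderiv ℝ f z (Pi.single i 1)) x (Pi.single j 1) =
        fderiv ℝ (fderiv ℝ f) x (Pi.single j 1) (Pi.single i 1) := fun i j => fderiv_fderiv_const_apply hf x _ _
    simp_rw [h1]
    rw [sum_sum_mul_sum_cov (fun j i => fderiv ℝ (fderiv ℝ f) x (Pi.single j 1) (Pi.single i 1))
      (fun (i : (Edge 3 L × Fin 2 × Fin 2 × Bool)) (n : Edge 3 L × NoiseIdx 2) => (if n.1 = i.1 then (fun z : ℂ => if i.2.2.2 then z.im else z.re) ((latticeLangevinDynamics (fundamentalLatticeRep 2) β').noise Q i.1 n.2 i.2.1 i.2.2.1) else 0))]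
    change ∑ n : Edge 3 L × NoiseIdx (fundamentalLatticeRep 2).N, _ = _
    refine Finset.sum_congr rfl fun n _ => ?_
    rw [sum_sum_apply_single_single_mul_mul (fderiv ℝ (fderiv ℝ f) x) (fun i => (if n.1 = i.1 then (fun z : ℂ => if i.2.2.2 then z.im else z.re) ((latticeLangevinDynamics (fundamentalLatticeRep 2) β').noise Q i.1 n.2 i.2.1 i.2.2.1) else 0)) (fun j => (if n.1 = j.1 then (fun z : ℂ => if j.2.2.2 then z.im else z.re) ((latticeLangevinDynamics (fundamentalLatticeRep 2) β').noise Q j.1 n.2 j.2.1 j.2.2.1) else 0))]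
    have hw : (fun i : (Edge 3 L × Fin 2 × Fin 2 × Bool) => (if n.1 = i.1 then (fun z : ℂ => if i.2.2.2 then z.im else z.re) ((latticeLangevinDynamics (fundamentalLatticeRep 2) β').noise Q i.1 n.2 i.2.1 i.2.2.1) else 0)) = s2 n x := funext fun i => (hsn n i).symm
    rw [hw]
  -- W_n W_n f = D²f[s_n,s_n] + Df[s_n s_n x]
  have hWW : ∀ n : Edge 3 L × NoiseIdx (fundamentalLatticeRep 2).N, fderiv ℝ (fun w => fderiv ℝ f w (s2 n w)) x (s2 n x) =
      fderiv ℝ (fderiv ℝ f) x (s2 n x) (s2 n x) + fderiv ℝ f x (s2 n (s2 n x)) :=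
    fun n => fderiv_frameDeriv_apply hf (s2 n) x (s2 n x)
  -- the Casimir drift
  have hcas : ∑ i : (Edge 3 L × Fin 2 × Fin 2 × Bool), fderiv ℝ f x (Pi.single i 1) *
      (fun z : ℂ => if i.2.2.2 then z.im else z.re) (((fundamentalLatticeRep 2).casimir * Q i.1) i.2.1 i.2.2.1) =
      1 / 2 * fderiv ℝ f x (∑ n : Edge 3 L × NoiseIdx (fundamentalLatticeRep 2).N, s2 n (s2 n x)) := by
    have hL : ∑ i : (Edge 3 L × Fin 2 × Fin 2 × Bool), fderiv ℝ f x (Pi.single i 1) *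
        (fun z : ℂ => if i.2.2.2 then z.im else z.re) (((fundamentalLatticeRep 2).casimir * Q i.1) i.2.1 i.2.2.1) =
        fderiv ℝ f x (fun i : (Edge 3 L × Fin 2 × Fin 2 × Bool) => (fun z : ℂ => if i.2.2.2 then z.im else z.re) (((fundamentalLatticeRep 2).casimir * Q i.1) i.2.1 i.2.2.1)) :=
      sum_apply_single_mul_eq_apply _ _
    have hC : (∑ n : Edge 3 L × NoiseIdx (fundamentalLatticeRep 2).N, s2 n (s2 n x)) =
        (fun q : (Edge 3 L × Fin 2 × Fin 2 × Bool) => (fun z : ℂ => if q.2.2.2 then z.im else z.re) ((((2 : ℝ) : ℂ) • ((fundamentalLatticeRep 2).casimir * Q q.1)) q.2.1 q.2.2.1)) := by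
      have h := hCas2 x
      rw [hreb] at h
      exact h
    have h2 : (∑ n : Edge 3 L × NoiseIdx (fundamentalLatticeRep 2).N, s2 n (s2 n x)) =
        (2 : ℝ) • fun i : (Edge 3 L × Fin 2 × Fin 2 × Bool) => (fun z : ℂ => if i.2.2.2 then z.im else z.re) (((fundamentalLatticeRep 2).casimir * Q i.1) i.2.1 i.2.2.1) := by
      rw [hC]
      funext i
      rw [Pi.smul_apply, smul_eq_mul]
      exact reIm_two_smul_casimir_mul Q i
    have hR : 1 / 2 * fderiv ℝ f x (∑ n : Edge 3 L × NoiseIdx (fundamentalLatticeRep 2).N, s2 n (s2 n x)) =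
        fderiv ℝ f x (fun i : (Edge 3 L × Fin 2 × Fin 2 × Bool) => (fun z : ℂ => if i.2.2.2 then z.im else z.re) (((fundamentalLatticeRep 2).casimir * Q i.1) i.2.1 i.2.2.1)) := by
      rw [h2, map_smul, smul_eq_mul]
      ring
    exact hL.trans hR.symm
  -- the `β'`-drift (SZZ Lemma 3.1 in coordinates)
  have hψC : ContDiff ℝ 2 ψ := contDiff_psiHat (d := 3) (L := L) (N := 2) (n := 2) β'
  have hdl : ∀ i : (Edge 3 L × Fin 2 × Fin 2 × Bool), (fun z : ℂ => if i.2.2.2 then z.im else z.re) (((fundamentalLatticeRep 2).driftLie β' Q i.1 * Q i.1) i.2.1 i.2.2.1) =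
      1 / 2 * ∑ q' : (Edge 3 L × Fin 2 × Fin 2 × Bool), (∑ n : Edge 3 L × NoiseIdx (fundamentalLatticeRep 2).N, (if n.1 = i.1 then (fun z : ℂ => if i.2.2.2 then z.im else z.re) ((latticeLangevinDynamics (fundamentalLatticeRep 2) β').noise Q i.1 n.2 i.2.1 i.2.2.1) else 0) * (if n.1 = q'.1 then (fun z : ℂ => if q'.2.2.2 then z.im else z.re) ((latticeLangevinDynamics (fundamentalLatticeRep 2) β').noise Q q'.1 n.2 q'.2.1 q'.2.2.1) else 0)) *
        fderiv ℝ ψ x (Pi.single q' 1) := fun i => driftLie_mul_entry_eq_half_sum β' Q i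
  have hterm1b : ∑ i : (Edge 3 L × Fin 2 × Fin 2 × Bool), fderiv ℝ f x (Pi.single i 1) *
      (fun z : ℂ => if i.2.2.2 then z.im else z.re) (((fundamentalLatticeRep 2).driftLie β' Q i.1 * Q i.1) i.2.1 i.2.2.1) =
      1 / 2 * ∑ n : Edge 3 L × NoiseIdx (fundamentalLatticeRep 2).N, fderiv ℝ ψ x (s2 n x) * fderiv ℝ f x (s2 n x) := by
    refine (Finset.sum_congr rfl fun i _ => congrArg (fun t => fderiv ℝ f x (Pi.single i 1) * t) (hdl i)).trans ?_
    refine (sum_mul_half_sum_cov (fun i : (Edge 3 L × Fin 2 × Fin 2 × Bool) => fderiv ℝ f x (Pi.single i 1))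
      (fun q' : (Edge 3 L × Fin 2 × Fin 2 × Bool) => fderiv ℝ ψ x (Pi.single q' 1))
      (fun (i : (Edge 3 L × Fin 2 × Fin 2 × Bool)) (n : Edge 3 L × NoiseIdx (fundamentalLatticeRep 2).N) => (if n.1 = i.1 then (fun z : ℂ => if i.2.2.2 then z.im else z.re) ((latticeLangevinDynamics (fundamentalLatticeRep 2) β').noise Q i.1 n.2 i.2.1 i.2.2.1) else 0))).trans ?_
    refine congrArg (fun t => 1 / 2 * t) (Finset.sum_congr rfl fun n _ => ?_)
    exact congrArg₂ (· * ·) (hsum1 (fderiv ℝ ψ x) n) (hsum1 (fderiv ℝ f x) n)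
  -- assemble
  have hdrift : ∀ i : (Edge 3 L × Fin 2 × Fin 2 × Bool), (fun z : ℂ => if i.2.2.2 then z.im else z.re)
      ((latticeLangevinDynamics (fundamentalLatticeRep 2) β').drift Q i.1 i.2.1 i.2.2.1) =
      (fun z : ℂ => if i.2.2.2 then z.im else z.re) (((fundamentalLatticeRep 2).driftLie β' Q i.1 * Q i.1) i.2.1 i.2.2.1) +
      (fun z : ℂ => if i.2.2.2 then z.im else z.re) (((fundamentalLatticeRep 2).casimir * Q i.1) i.2.1 i.2.2.1) :=
    fun i => drift_reIm_split' β' Q i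
  have hterm1 : ∑ i : (Edge 3 L × Fin 2 × Fin 2 × Bool), fderiv ℝ f x (Pi.single i 1) * (fun z : ℂ => if i.2.2.2 then z.im else z.re)
      ((latticeLangevinDynamics (fundamentalLatticeRep 2) β').drift Q i.1 i.2.1 i.2.2.1) =
      1 / 2 * ∑ n : Edge 3 L × NoiseIdx (fundamentalLatticeRep 2).N, fderiv ℝ ψ x (s2 n x) * fderiv ℝ f x (s2 n x) +
        1 / 2 * fderiv ℝ f x (∑ n : Edge 3 L × NoiseIdx (fundamentalLatticeRep 2).N, s2 n (s2 n x)) := by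
    refine (Finset.sum_congr rfl fun i _ =>
      (congrArg (fun t => fderiv ℝ f x (Pi.single i 1) * t) (hdrift i)).trans (mul_add _ _ _)).trans ?_
    rw [Finset.sum_add_distrib, hterm1b, hcas]
  have hsplit : fderiv ℝ f x (∑ n : Edge 3 L × NoiseIdx (fundamentalLatticeRep 2).N, s2 n (s2 n x)) =
      ∑ n : Edge 3 L × NoiseIdx (fundamentalLatticeRep 2).N, fderiv ℝ f x (s2 n (s2 n x)) := map_sum _ _ _
  have hgoal : gen f V = ∑ i : (Edge 3 L × Fin 2 × Fin 2 × Bool), fderiv ℝ f x (Pi.single i 1) * (fun z : ℂ => if i.2.2.2 then z.im else z.re)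
      ((latticeLangevinDynamics (fundamentalLatticeRep 2) β').drift Q i.1 i.2.1 i.2.2.1) +
    1 / 2 * ∑ i : (Edge 3 L × Fin 2 × Fin 2 × Bool), ∑ j : (Edge 3 L × Fin 2 × Fin 2 × Bool), fderiv ℝ (fun z => fderiv ℝ f z (Pi.single i 1)) x (Pi.single j 1) *
      ∑ n : Edge 3 L × NoiseIdx 2, (if n.1 = i.1 then (fun z : ℂ => if i.2.2.2 then z.im else z.re) ((latticeLangevinDynamics (fundamentalLatticeRep 2) β').noise Q i.1 n.2 i.2.1 i.2.2.1) else 0) * (if n.1 = j.1 then (fun z : ℂ => if j.2.2.2 then z.im else z.re) ((latticeLangevinDynamics (fundamentalLatticeRep 2) β').noise Q j.1 n.2 j.2.1 j.2.2.1) else 0) := rfl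
  rw [hgoal, hterm1, hterm2, hsplit]
  show _ = 1 / 2 * ∑ n : Edge 3 L × NoiseIdx (fundamentalLatticeRep 2).N,
      (fderiv ℝ (fun w => fderiv ℝ f w (s2 n w)) x (s2 n x) + fderiv ℝ ψ x (s2 n x) * fderiv ℝ f x (s2 n x))
  have hRHS : ∑ n : Edge 3 L × NoiseIdx (fundamentalLatticeRep 2).N, (fderiv ℝ (fun w => fderiv ℝ f w (s2 n w)) x (s2 n x) +
      fderiv ℝ ψ x (s2 n x) * fderiv ℝ f x (s2 n x)) =
      ∑ n : Edge 3 L × NoiseIdx (fundamentalLatticeRep 2).N, (fderiv ℝ (fderiv ℝ f) x (s2 n x) (s2 n x) + fderiv ℝ f x (s2 n (s2 n x)) +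
        fderiv ℝ ψ x (s2 n x) * fderiv ℝ f x (s2 n x)) := Finset.sum_congr rfl fun n _ => by rw [hWW n]
  rw [hRHS]
  simp only [mul_add, Finset.sum_add_distrib, Finset.mul_sum]
  ring

end Summit.QuantumFields.YangMills.Theorems.ColdStartUniversality
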